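import Literature.NumberTheory.LFunctions.DobnerSelbergClass
import HarnessLib

/-!
# Dobner's deformed Dirichlet series `F_t` for `F ∈ 𝒮♯` (arXiv:2005.05142, Thm. 4, eq. for `F_t`)

RH-FREE literature definitions (no named facts). Trunk T-ANT (`Literature/NumberTheory/LFunctions`),
companion of `DobnerSelbergClass.lean` (the class `𝒮♯`) and `DobnerNewman.lean` (the case
`F = ζ`: `Literature.NumberTheory.LFunctions.zetaDeformed`).

> A. Dobner, *A proof of Newman's conjecture for the extended Selberg class*, Acta Arith. 201
> (2021) = arXiv:2005.05142, **Thm. 4** (p. 8 of the held arXiv text), display defining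
> `F_t(s) := ∑_{n≥1} exp(−(|t|/4) log² n) aₙ n^{−s}` (`t < 0`), and §3.1, p. 8: "`F_t` is
> everywhere absolutely convergent … the factor `exp(−(|t|/4) log² n)` decays faster than
> `O(n^{−d})` for any `d` whereas `aₙ = O(n²)`".

## Contents (all proved)

* `Literature.NumberTheory.LFunctions.ExtendedSelbergDatum.deformedCoeff D t n = e^{(t/4) log² n} aₙ`
  (the tree's `zetaDeformedCoeff t n` times `aₙ`) and
  `Literature.NumberTheory.LFunctions.ExtendedSelbergDatum.Ft D t = LSeries (deformedCoeff D t)`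
  — Dobner's `F_t` for the datum `D` (for `t < 0`, `e^{(t/4) log² n} = e^{−(|t|/4) log² n}`);
* `Ft_zero_eq`: `F_0 = F` on `Re s > 1`;
* `summable_deformedCoeff` / `abscissaOfAbsConv_deformedCoeff` / `differentiable_Ft`: for
  `t < 0`, `F_t` converges absolutely everywhere (`aₙ = O(n²)`,
  `ExtendedSelbergDatum.coeff_isBigO_sq`, against the tree's `zetaDeformed_summable`) and is entire.

These are the `𝒮♯`-versions of the objects of `DobnerNewman.lean` needed for the `𝒮♯`-generality of
Dobner's Lemma 3 / Thm. 4 / Thm. 2 (architecture note, rt/STATUS 2026-08-26); nothing about `J_t`,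
`γ_t` here yet.

bears_on: N-C/N-P (COLUMN 3 DBN). WHAT THIS IS NOT: nothing here bears on the truth of RH.
-/

noncomputable section

open Complex Filter Set Asymptotics

namespace Literature.NumberTheory.LFunctions

namespace ExtendedSelbergDatum

variable (D : ExtendedSelbergDatum)

/-- The coefficients `e^{(t/4) log² n} aₙ` of Dobner's `F_t` (for `t < 0` the source writes
`exp(−(|t|/4) log² n) aₙ`). [cite: Dobner2021, Thm. 4 (definition of F_t), p. 8] -/
def deformedCoeff (t : ℝ) (n : ℕ) : ℂ :=
  zetaDeformedCoeff t n * D.coeff n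

/-- Dobner's deformed Dirichlet series `F_t(s) = ∑_{n ≥ 1} e^{(t/4) log² n} aₙ n^{−s}` of the datum,
as an `LSeries`. [cite: Dobner2021, Thm. 4 (definition of F_t), p. 8] -/
def Ft (t : ℝ) (s : ℂ) : ℂ :=
  LSeries (D.deformedCoeff t) s

/-- Unfolding of `F_t`. [cite: Dobner2021, Thm. 4 (definition of F_t), p. 8] -/
theorem Ft_apply (t : ℝ) (s : ℂ) : D.Ft t s = LSeries (D.deformedCoeff t) s := rfl

/-- At `t = 0` the coefficients are the `aₙ`. [cite: Dobner2021, §3 p. 8] -/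
theorem deformedCoeff_zero : D.deformedCoeff 0 = D.coeff := by
  funext n; simp [deformedCoeff, zetaDeformedCoeff]

/-- `F_0 = F` on the half-plane of absolute convergence `Re s > 1`. [cite: Dobner2021, §3 p. 8] -/
theorem Ft_zero_eq {s : ℂ} (hs : 1 < s.re) : D.Ft 0 s = D.toFun s := by
  rw [Ft, deformedCoeff_zero, D.eqOn_LSeries hs]

/-- The terms of `F_t` against those of `ζ_t` two units to the left: eventually
`‖term (deformedCoeff t) s n‖ ≤ C ‖term (zetaDeformedCoeff t) (s − 2) n‖`, from `aₙ = O(n²)`.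
[cite: Dobner2021, §3.1 p. 8] -/
theorem norm_term_deformedCoeff_le (t : ℝ) (s : ℂ) : ∃ C : ℝ, ∀ᶠ n : ℕ in atTop,
    ‖LSeries.term (D.deformedCoeff t) s n‖ ≤ C * ‖LSeries.term (zetaDeformedCoeff t) (s - 2) n‖ := by
  obtain ⟨C, hC⟩ := Asymptotics.isBigO_iff.1 D.coeff_isBigO_sq
  refine ⟨C, ?_⟩
  filter_upwards [hC, eventually_ne_atTop 0] with n hn hn0
  have hnpos : (0 : ℝ) < n := by exact_mod_cast Nat.pos_of_ne_zero hn0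
  rw [LSeries.term_of_ne_zero hn0, LSeries.term_of_ne_zero hn0, deformedCoeff, norm_div, norm_div,
    norm_mul, Complex.norm_natCast_cpow_of_pos (Nat.pos_of_ne_zero hn0),
    Complex.norm_natCast_cpow_of_pos (Nat.pos_of_ne_zero hn0), Complex.sub_re,
    show (2 : ℂ).re = 2 by norm_num, Real.rpow_sub hnpos, Real.rpow_two]
  rw [Real.norm_of_nonneg (by positivity)] at hn
  have h0 : 0 ≤ ‖zetaDeformedCoeff t n‖ := norm_nonneg _
  have hn2 : (0 : ℝ) < (n : ℝ) ^ 2 := by positivity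
  have hns : (0 : ℝ) < (n : ℝ) ^ s.re := Real.rpow_pos_of_pos hnpos _
  rw [div_div_eq_mul_div]
  calc ‖zetaDeformedCoeff t n‖ * ‖D.coeff n‖ / (n : ℝ) ^ s.re
      ≤ ‖zetaDeformedCoeff t n‖ * (C * (n : ℝ) ^ 2) / (n : ℝ) ^ s.re := by
        gcongr
    _ = C * (‖zetaDeformedCoeff t n‖ * (n : ℝ) ^ 2 / (n : ℝ) ^ s.re) := by ring

/-- For `t < 0`, `F_t` converges absolutely at every `s` ("`F_t` is everywhere absolutely
convergent", §3.1 p. 8). [cite: Dobner2021, §3.1 p. 8] -/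
theorem summable_deformedCoeff {t : ℝ} (ht : t < 0) (s : ℂ) : LSeriesSummable (D.deformedCoeff t) s := by
  obtain ⟨C, hC⟩ := D.norm_term_deformedCoeff_le t s
  have hζ := (zetaDeformed_summable ht (s - 2)).norm.mul_left C
  exact Summable.of_norm_bounded_eventually_nat hζ hC

/-- For `t < 0`, the abscissa of absolute convergence of `F_t` is `−∞`. [cite: Dobner2021, §3.1 p. 8] -/
theorem abscissaOfAbsConv_deformedCoeff {t : ℝ} (ht : t < 0) :
    LSeries.abscissaOfAbsConv (D.deformedCoeff t) = ⊥ :=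
  le_antisymm (LSeries.abscissaOfAbsConv_le_of_forall_lt_LSeriesSummable' fun x _ ↦
    D.summable_deformedCoeff ht x) bot_le

/-- For `t < 0`, `F_t` is an entire function ("Because `F_t` is everywhere absolutely convergent
it is entire", §3.1 p. 8). [cite: Dobner2021, §3.1 p. 8] -/
theorem differentiable_Ft {t : ℝ} (ht : t < 0) : Differentiable ℂ (D.Ft t) := by
  intro s
  have hmem : s ∈ {z : ℂ | LSeries.abscissaOfAbsConv (D.deformedCoeff t) < z.re} := by
    rw [mem_setOf_eq, D.abscissaOfAbsConv_deformedCoeff ht]; exact EReal.bot_lt_coe _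
  exact ((LSeries_differentiableOn (D.deformedCoeff t)) s hmem).differentiableAt
    ((isOpen_re_gt_EReal _).mem_nhds hmem)

end ExtendedSelbergDatum

end Literature.NumberTheory.LFunctions

end
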